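import Mathlib
import Summits.SmoothPoincare4.SmoothPoincare4.Theorems.CylinderEntropySliceIsolationCertArith
import Literature.Analysis.ValidatedNumerics.FixedPointInterval
import HarnessLib

/-!
# Kernel certificate checker for `stub_certMid`, I: outward-rounded rational intervals

Infrastructure file 1 for the kernel-clean (standard axioms, `decide +kernel`) discharge of the registered stub
`stub_certMid` of crux stmt-SmoothPoincare4-7631 (`Summit.SmoothPoincare4.SmoothPoincare4.Theses.CylinderEntropy.CylinderRungTwo`,
line `killing-flux`): a minimal interval arithmetic over `ℚ` with directed dyadic rounding
(`Cert.rdn` / `Cert.rup` / `Cert.expLo` / `Cert.expHi` of `…CylinderEntropySliceIsolationCertArith`).  An `Ivl` is a pair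
`⟨lo, hi⟩ : ℚ × ℚ` standing for `[lo, hi] ⊂ ℝ` (`Ivl.mem`); every operation is computable and comes with its inclusion
theorem (`mem_add`, `mem_sub`, `mem_neg`, `mem_mul`, `mem_scale`, `mem_round`, `mem_hull_*`, `mem_exp`, `mem_invPos`,
`abs_le_absHi`, `mem_of_le`).  No definitions of mathematical content, no named facts.
-/

-- the registered namespace `Summit.SmoothPoincare4.SmoothPoincare4.…` repeats a component
set_option linter.dupNamespace false

namespace Summit.SmoothPoincare4.SmoothPoincare4.Cruxes.CylinderRungTwo.KillingFlux

namespace KCert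

open Summit.SmoothPoincare4.SmoothPoincare4.Theorems.CylinderEntropySliceIsolation.Cert

/-- A closed interval with rational end points. [folklore] -/
structure Ivl where
  /-- lower end point -/
  lo : ℚ
  /-- upper end point -/
  hi : ℚ

namespace Ivl

/-- `x ∈ [lo, hi]`. [folklore] -/
def mem (x : ℝ) (I : Ivl) : Prop := (I.lo : ℝ) ≤ x ∧ x ≤ (I.hi : ℝ)

/-- The point interval `[q, q]`. [folklore] -/
def pt (q : ℚ) : Ivl := ⟨q, q⟩

/-- Outward rounding to `p` fractional bits. [folklore] -/
def round (I : Ivl) (p : ℕ) : Ivl := ⟨rdn I.lo p, rup I.hi p⟩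

/-- Sum. [folklore] -/
def add (I J : Ivl) : Ivl := ⟨I.lo + J.lo, I.hi + J.hi⟩

/-- Difference. [folklore] -/
def sub (I J : Ivl) : Ivl := ⟨I.lo - J.hi, I.hi - J.lo⟩

/-- Negation. [folklore] -/
def neg (I : Ivl) : Ivl := ⟨-I.hi, -I.lo⟩

/-- Product (four corners), rounded outward to `p` bits. [folklore] -/
def mul (I J : Ivl) (p : ℕ) : Ivl :=
  let a := I.lo * J.lo
  let b := I.lo * J.hi
  let c := I.hi * J.lo
  let d := I.hi * J.hi
  ⟨rdn (min (min a b) (min c d)) p, rup (max (max a b) (max c d)) p⟩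

/-- Exact product with a rational constant. [folklore] -/
def scale (I : Ivl) (q : ℚ) : Ivl := if 0 ≤ q then ⟨I.lo * q, I.hi * q⟩ else ⟨I.hi * q, I.lo * q⟩

/-- Convex hull of two intervals. [folklore] -/
def hull (I J : Ivl) : Ivl := ⟨min I.lo J.lo, max I.hi J.hi⟩

/-- An upper bound of `|x|` on the interval. [folklore] -/
def absHi (I : Ivl) : ℚ := max (-I.lo) I.hi

/-- Enclosure of `exp` (monotone, end points by `expLo` / `expHi`). [folklore] -/
def exp (I : Ivl) (p : ℕ) : Ivl := ⟨expLo I.lo p, expHi I.hi p⟩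

/-- Enclosure of `x⁻¹` on an interval with positive lower end point (else the junk `[0, 0]`). [folklore] -/
def invPos (I : Ivl) (p : ℕ) : Ivl := if 0 < I.lo then ⟨rdn (1 / I.hi) p, rup (1 / I.lo) p⟩ else ⟨0, 0⟩

variable {x y : ℝ} {I J : Ivl}

/-- [folklore] -/
theorem mem_def : mem x I ↔ (I.lo : ℝ) ≤ x ∧ x ≤ (I.hi : ℝ) := Iff.rfl

/-- [folklore] -/
theorem mem_pt (q : ℚ) : mem (q : ℝ) (pt q) := ⟨le_rfl, le_rfl⟩

/-- A wider pair of end points still encloses. [folklore] -/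
theorem mem_of_le (h : mem x I) {lo hi : ℚ} (h1 : lo ≤ I.lo) (h2 : I.hi ≤ hi) : mem x ⟨lo, hi⟩ :=
  ⟨le_trans (by exact_mod_cast h1) h.1, h.2.trans (by exact_mod_cast h2)⟩

/-- [folklore] -/
theorem mem_round (h : mem x I) (p : ℕ) : mem x (I.round p) :=
  ⟨(rdn_le_real _ _).trans h.1, h.2.trans (le_rup_real _ _)⟩

/-- [folklore] -/
theorem mem_add (hx : mem x I) (hy : mem y J) : mem (x + y) (I.add J) := by
  obtain ⟨h1, h2⟩ := hx; obtain ⟨h3, h4⟩ := hy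
  refine ⟨?_, ?_⟩ <;> simp only [add, Rat.cast_add] <;> linarith

/-- [folklore] -/
theorem mem_sub (hx : mem x I) (hy : mem y J) : mem (x - y) (I.sub J) := by
  obtain ⟨h1, h2⟩ := hx; obtain ⟨h3, h4⟩ := hy
  refine ⟨?_, ?_⟩ <;> simp only [sub, Rat.cast_sub] <;> linarith

/-- [folklore] -/
theorem mem_neg (hx : mem x I) : mem (-x) I.neg := by
  obtain ⟨h1, h2⟩ := hx
  refine ⟨?_, ?_⟩ <;> simp only [neg, Rat.cast_neg] <;> linarith

/-- [folklore] -/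
theorem mem_mul (hx : mem x I) (hy : mem y J) (p : ℕ) : mem (x * y) (I.mul J p) := by
  obtain ⟨h1, h2⟩ := Literature.Analysis.ValidatedNumerics.Numerics.FI.mul_mem_corners hx hy
  refine ⟨(rdn_le_real _ _).trans ?_, le_trans ?_ (le_rup_real _ _)⟩
  · push_cast; exact h1
  · push_cast; exact h2

/-- [folklore] -/
theorem mem_scale (hx : mem x I) (q : ℚ) : mem (x * q) (I.scale q) := by
  obtain ⟨h1, h2⟩ := hx
  unfold scale
  split_ifs with hq
  · have hq' : (0 : ℝ) ≤ q := by exact_mod_cast hq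
    exact ⟨by push_cast; nlinarith, by push_cast; nlinarith⟩
  · have hq' : (q : ℝ) ≤ 0 := by exact_mod_cast (not_le.1 hq).le
    exact ⟨by push_cast; nlinarith, by push_cast; nlinarith⟩

/-- [folklore] -/
theorem mem_hull_left (hx : mem x I) (J : Ivl) : mem x (I.hull J) :=
  ⟨le_trans (by push_cast [hull]; exact min_le_left _ _) hx.1,
    hx.2.trans (by push_cast [hull]; exact le_max_left _ _)⟩

/-- [folklore] -/
theorem mem_hull_right (hx : mem x J) (I : Ivl) : mem x (I.hull J) :=
  ⟨le_trans (by push_cast [hull]; exact min_le_right _ _) hx.1,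
    hx.2.trans (by push_cast [hull]; exact le_max_right _ _)⟩

/-- Hull of two enclosed points encloses everything in between. [folklore] -/
theorem mem_hull_of_between {u v : ℝ} (hu : mem u I) (hv : mem v J) (h1 : u ≤ x) (h2 : x ≤ v) :
    mem x (I.hull J) :=
  ⟨(mem_hull_left hu J).1.trans h1, h2.trans (mem_hull_right hv I).2⟩

/-- [folklore] -/
theorem abs_le_absHi (hx : mem x I) : |x| ≤ (I.absHi : ℝ) := by
  obtain ⟨h1, h2⟩ := hx
  simp only [absHi]
  push_cast
  rw [abs_le]
  constructor
  · have : (-(I.lo : ℝ)) ≤ max (-(I.lo : ℝ)) (I.hi : ℝ) := le_max_left _ _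
    linarith
  · exact h2.trans (le_max_right _ _)

/-- `0 ≤ absHi` on a nonempty interval. [folklore] -/
theorem absHi_nonneg (hx : mem x I) : (0 : ℝ) ≤ (I.absHi : ℝ) :=
  (abs_nonneg x).trans (abs_le_absHi hx)

/-- [folklore] -/
theorem mem_exp (hx : mem x I) (p : ℕ) : mem (Real.exp x) (I.exp p) :=
  ⟨(expLo_le _ _).trans (Real.exp_le_exp.2 hx.1), (Real.exp_le_exp.2 hx.2).trans (exp_le_expHi _ _)⟩

/-- [folklore] -/
theorem mem_invPos (hx : mem x I) (h0 : 0 < I.lo) (p : ℕ) : mem x⁻¹ (I.invPos p) := by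
  obtain ⟨h1, h2⟩ := hx
  have h0' : (0 : ℝ) < (I.lo : ℝ) := by exact_mod_cast h0
  have hxpos : 0 < x := h0'.trans_le h1
  have hhi : (0 : ℝ) < (I.hi : ℝ) := hxpos.trans_le h2
  simp only [invPos, h0, ↓reduceIte]
  constructor
  · refine (rdn_le_real _ _).trans ?_
    push_cast
    rw [one_div]
    exact inv_anti₀ hxpos h2
  · refine le_trans ?_ (le_rup_real _ _)
    push_cast
    rw [one_div]
    exact inv_anti₀ h0' h1

/-- An interval with a member has `lo ≤ hi` (over `ℝ`). [folklore] -/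
theorem lo_le_hi (hx : mem x I) : (I.lo : ℝ) ≤ (I.hi : ℝ) := hx.1.trans hx.2

/-- Membership from real bounds that dominate the end points. [folklore] -/
theorem mem_of_bounds {a b : ℝ} (ha : (I.lo : ℝ) ≤ a) (hb : b ≤ (I.hi : ℝ)) (h1 : a ≤ x) (h2 : x ≤ b) :
    mem x I := ⟨ha.trans h1, h2.trans hb⟩

end Ivl

end KCert

/-- Registered sub-goal marker `stub_certMid_part1` of crux stmt-SmoothPoincare4-7631 (helper file 1/6 of the kernel-clean
`stub_certMid`, line killing-flux): the absolute-value bound behind `KCert.Ivl.absHi`. [folklore] -/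
theorem stub_certMid_part1 : ∀ (lo hi x : ℝ), lo ≤ x ∧ x ≤ hi → |x| ≤ max (-lo) hi := by
  intro lo hi x h
  rw [abs_le]
  constructor
  · have : -lo ≤ max (-lo) hi := le_max_left _ _
    linarith [h.1]
  · exact h.2.trans (le_max_right _ _)

end Summit.SmoothPoincare4.SmoothPoincare4.Cruxes.CylinderRungTwo.KillingFlux
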